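import Literature.Computability.QuantumComplexity.ZXCalculusTriangleLemmas
import HarnessLib

/-!
# ZX-calculus, Layer T7: Appendix Lemma 36 (parallel triangles) and its local tools

[cite: JeandelPerdrixVilmart2018, Appendix Lemma 36]; proof architecture after Jeandel–Perdrix–Vilmart,
arXiv:1705.11151 (v2), Appendix (fig. `parallel-triangles-are-projections-proof`), with the (B2)/(B1) steps
replaced by the local disconnection lemma `split_Xhalfpi_hBox_merge` (a green node doubly linked to another
green node by an `X(π/2)`-edge and an `H`-edge disconnects).
-/

namespace Literature.Computability.QuantumComplexity

open ZXDiagram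

namespace ZXClass

/-- `X(π/2) = Z(-π/2) ⨾ (1/√2 ⊗ db 4 1 ⊗ H) ⨾ Z(-π/2)` (Euler). [cite: JeandelPerdrixVilmart2018, Appendix Lemma 16] -/
theorem X_halfpi_eq_euler : mk (X 1 1 2) = mk (Z 1 1 (-2)) ⨟ (mk invSqrtTwo ⊠ (mk (dumbbell 4 1) ⊠ mk hBox)) ⨟ mk (Z 1 1 (-2)) := by
  rw [← euler_pos, ← seq_assoc, ← seq_assoc, phase_seq_phase, seq_assoc, seq_assoc, phase_seq_phase,
    show (-2 : ZMod 8) + 2 = 0 from by decide, show (2 : ZMod 8) + -2 = 0 from by decide, Z_one_one, id_seq, seq_id]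

/-- Scalars on the first factor of a `1,1` parallel pair float out. [folklore] -/
theorem scalar_par_one_par_one (s : ZXClass 0 0) (A C : ZXClass 1 1) : (s ⊠ A) ⊠ C = s ⊠ (A ⊠ C) :=
  (par_assoc _ _ _).trans (cast_id _ _ _)

/-- A scalar in front of a `1 → 2 → 2` composite floats out. [folklore] -/
theorem scalar_par_one_two_seq_two (s : ZXClass 0 0) (A : ZXClass 1 2) (B : ZXClass 2 2) : (s ⊠ A) ⨟ B = s ⊠ (A ⨟ B) := by
  rw [scalar_par_seq_left, empty_par, cast_id]

/-- The core of `split_Xhalfpi_hBox_merge`: `2 ⊗ (Z^{(1,2)} ⨾ (Z(-π/2) ⊗ 𝕀) ⨾ (H ⊗ 𝕀) ⨾ (Z(-π/2) ⊗ 𝕀) ⨾ (𝕀 ⊗ H) ⨾ Z^{(2,1)}) = Z^{(1,0)}(-π/2) ⨾ Z^{(0,1)}(-π/2)`.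
[cite: JeandelPerdrixVilmart2018, Appendix Lemmas 2, 16] -/
theorem split_hBoxes_merge_phases :
    mk (dumbbell 0 0) ⊠ (mk (dumbbell 0 0) ⊠ (mk (Z 1 2 0) ⨟ (mk (Z 1 1 (-2)) ⊠ mk (wires 1)) ⨟ (mk hBox ⊠ mk (wires 1)) ⨟ (mk (Z 1 1 (-2)) ⊠ mk (wires 1)) ⨟
      (mk (wires 1) ⊠ mk hBox) ⨟ mk (Z 2 1 0))) = mk (Z 1 0 (-2)) ⨟ mk (Z 0 1 (-2)) := by
  rw [Z_seq_Z_par 1 1 1 1 le_rfl, add_zero (-2 : ZMod 8), show mk (Z 1 2 (-2)) = mk (Z 1 1 (-2)) ⨟ mk (Z 1 2 0) from by rw [Z_seq_Z 1 1 2 le_rfl, add_zero],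
    seq_assoc _ (mk (Z 1 1 (-2)) ⊠ mk (wires 1)) (mk (wires 1) ⊠ mk hBox),
    show (mk (Z 1 1 (-2)) ⊠ mk (wires 1)) ⨟ (mk (wires 1) ⊠ mk hBox) = (mk (wires 1) ⊠ mk hBox) ⨟ (mk (Z 1 1 (-2)) ⊠ mk (wires 1)) from by
      rw [← par_eq_seq_left, ← par_eq_seq_right],
    ← seq_assoc _ (mk (wires 1) ⊠ mk hBox) (mk (Z 1 1 (-2)) ⊠ mk (wires 1)), seq_assoc _ (mk (Z 1 1 (-2)) ⊠ mk (wires 1)) (mk (Z 2 1 0)),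
    Z_par_seq_Z 1 1 1 1 le_rfl, add_zero (-2 : ZMod 8), show mk (Z 2 1 (-2)) = mk (Z 2 1 0) ⨟ mk (Z 1 1 (-2)) from by rw [Z_seq_Z 2 1 1 le_rfl, zero_add],
    seq_assoc _ (mk hBox ⊠ mk (wires 1)) (mk (wires 1) ⊠ mk hBox), ← par_eq_seq_left]
  simp only [seq_assoc]
  rw [← seq_scalar_par_one (mk (dumbbell 0 0)) (mk (Z 1 1 (-2))), ← seq_scalar_par_one (mk (dumbbell 0 0)) (mk (Z 1 1 (-2))),
    ← seq_assoc (mk hBox ⊠ mk hBox) (mk (Z 2 1 0)) (mk (Z 1 1 (-2))), ← seq_assoc (mk (Z 1 2 0)) ((mk hBox ⊠ mk hBox) ⨟ mk (Z 2 1 0)) (mk (Z 1 1 (-2))),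
    ← seq_assoc (mk (Z 1 2 0)) (mk hBox ⊠ mk hBox) (mk (Z 2 1 0)),
    ← scalar_par_seq_one (mk (dumbbell 0 0)) _ (mk (Z 1 1 (-2))), ← scalar_par_seq_one (mk (dumbbell 0 0)) _ (mk (Z 1 1 (-2))), hopf_hBox,
    seq_assoc (mk (Z 1 0 0)), Z_seq_Z 0 1 1 le_rfl, zero_add (-2 : ZMod 8), ← seq_assoc, Z_seq_Z 1 1 0 le_rfl, add_zero (-2 : ZMod 8)]

/-- **Local disconnection**: a green split and a green merge joined by an `X(π/2)`-edge and an `H`-edge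
disconnect: `2 ⊗ (Z^{(1,2)} ⨾ (X(π/2) ⊗ H) ⨾ Z^{(2,1)}) = (1/√2 ⊗ db 4 1) ⊗ (Z^{(1,0)}(-π/2) ⨾ Z^{(0,1)}(-π/2))`
(Euler + the Hadamard Hopf law). [cite: JeandelPerdrixVilmart2018, Appendix Lemmas 2, 16] -/
theorem split_Xhalfpi_hBox_merge :
    mk (dumbbell 0 0) ⊠ (mk (dumbbell 0 0) ⊠ (mk (Z 1 2 0) ⨟ (mk (X 1 1 2) ⊠ mk hBox) ⨟ mk (Z 2 1 0))) =
      mk invSqrtTwo ⊠ (mk (dumbbell 4 1) ⊠ (mk (Z 1 0 (-2)) ⨟ mk (Z 0 1 (-2)))) := by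
  rw [show mk (X 1 1 2) ⊠ mk hBox = ((mk (Z 1 1 (-2)) ⊠ mk (wires 1)) ⨟ ((mk invSqrtTwo ⊠ (mk (dumbbell 4 1) ⊠ mk hBox)) ⊠ mk (wires 1)) ⨟
      (mk (Z 1 1 (-2)) ⊠ mk (wires 1))) ⨟ (mk (wires 1) ⊠ mk hBox) from by rw [X_halfpi_eq_euler, ← seq_par_wires, ← seq_par_wires, ← par_eq_seq_left],
    scalar_par_one_par_one, scalar_par_one_par_one, two_two_seq_scalar_par_two, two_two_seq_scalar_par_two, scalar_par_two_two_seq_two,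
    scalar_par_two_two_seq_two, scalar_par_two_two_seq_two, scalar_par_two_two_seq_two, one_two_seq_scalar_par_two, one_two_seq_scalar_par_two,
    scalar_par_one_two_seq_one, scalar_par_one_two_seq_one, scalar_par_scalar_par (mk (dumbbell 0 0)) (mk invSqrtTwo),
    scalar_par_scalar_par (mk (dumbbell 0 0)) (mk (dumbbell 4 1)), scalar_par_scalar_par (mk (dumbbell 0 0)) (mk invSqrtTwo),
    scalar_par_scalar_par (mk (dumbbell 0 0)) (mk (dumbbell 4 1)), ← seq_assoc (mk (Z 1 2 0)), ← seq_assoc (mk (Z 1 2 0)), ← seq_assoc (mk (Z 1 2 0)),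
    split_hBoxes_merge_phases]

/-- The `H`-capped edge between the inner outputs of two green splits (the "hedge" of the (C) rule). [cite: JeandelPerdrixVilmart2018, Fig. 1 (C)] -/
theorem hedge_inner_eq :
    mk (Z 1 2 0) ⨟ ((mk (X 1 1 2) ⨟ mk (Z 1 2 1)) ⊠ mk (wires 1)) ⨟ (mk (wires 1) ⊠ ((mk hBox ⊠ mk (wires 1)) ⨟ mk cap)) =
      mk (Z 1 2 0) ⨟ (mk (X 1 1 2) ⊠ mk hBox) ⨟ mk (Z 2 1 0) ⨟ mk (Z 1 1 1) := by
  rw [hBox_par_seq_cap_comm, wires_par_seq, show mk (wires 1) ⊠ (mk (wires 1) ⊠ mk hBox) = mk (wires 2) ⊠ mk hBox from by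
      rw [← wires_par_wires 1 1]; exact (par_assoc' _ _ _).trans (cast_id _ _ _),
    seq_assoc (mk (Z 1 2 0)), ← seq_assoc ((mk (X 1 1 2) ⨟ mk (Z 1 2 1)) ⊠ mk (wires 1)),
    show ((mk (X 1 1 2) ⨟ mk (Z 1 2 1)) ⊠ mk (wires 1)) ⨟ (mk (wires 2) ⊠ mk hBox) = (mk (wires 1) ⊠ mk hBox) ⨟ ((mk (X 1 1 2) ⨟ mk (Z 1 2 1)) ⊠ mk (wires 1)) from by
      rw [← par_eq_seq_left, ← par_eq_seq_right],
    seq_par_wires, show mk (Z 1 2 1) = mk (Z 1 1 1) ⨟ mk (Z 1 2 0) from by rw [Z_seq_Z 1 1 2 le_rfl, add_zero], seq_par_wires,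
    seq_assoc (mk (wires 1) ⊠ mk hBox), seq_assoc (mk (X 1 1 2) ⊠ mk (wires 1)), seq_assoc (mk (Z 1 1 1) ⊠ mk (wires 1)), split_par_seq_par_cap,
    Z_par_seq_Z 1 1 1 1 le_rfl, add_zero (1 : ZMod 8), show mk (Z 2 1 1) = mk (Z 2 1 0) ⨟ mk (Z 1 1 1) from by rw [Z_seq_Z 2 1 1 le_rfl, zero_add],
    ← seq_assoc (mk (wires 1) ⊠ mk hBox), show (mk (wires 1) ⊠ mk hBox) ⨟ (mk (X 1 1 2) ⊠ mk (wires 1)) = mk (X 1 1 2) ⊠ mk hBox from (par_eq_seq_right _ _).symm]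
  simp only [seq_assoc]

/-- **Step 6 of Lemma 36**: the green `π`-split feeding `X(π/2)` into the controlled-`Z` gadget `CZ(π/4,-π/4)` disconnects:
`4 ⊗ (Z^{(1,2)}(π) ⨾ (X(π/2) ⊗ 𝕀) ⨾ (Z^{(1,2)}(π/4) ⊗ Z^{(1,2)}(-π/4)) ⨾ hedge) = (1/√2 ⊗ db 4 1) ⊗ (Z^{(0,1)}(-π/4) ⊗ Z(π/4))`.
[cite: JeandelPerdrixVilmart2018, Appendix Lemma 36 (proof)] -/
theorem pi_split_Xhalfpi_CZ :
    mk (dumbbell 0 0) ⊠ (mk (dumbbell 0 0) ⊠ (mk (Z 1 2 4) ⨟ (mk (X 1 1 2) ⊠ mk (wires 1)) ⨟ (mk (Z 1 2 1) ⊠ mk (Z 1 2 (-1))) ⨟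
      ((mk (wires 1) ⊠ ((mk hBox ⊠ mk (wires 1)) ⨟ mk cap)) ⊠ mk (wires 1)))) =
      mk invSqrtTwo ⊠ (mk (dumbbell 4 1) ⊠ (mk (Z 0 1 (-1)) ⊠ mk (Z 1 1 1))) := by
  have h1 : mk (Z 1 2 4) ⨟ (mk (X 1 1 2) ⊠ mk (wires 1)) ⨟ (mk (Z 1 2 1) ⊠ mk (Z 1 2 (-1))) ⨟ ((mk (wires 1) ⊠ ((mk hBox ⊠ mk (wires 1)) ⨟ mk cap)) ⊠ mk (wires 1)) =
      mk (Z 1 2 3) ⨟ ((mk (Z 1 2 0) ⨟ (mk (X 1 1 2) ⊠ mk hBox) ⨟ mk (Z 2 1 0) ⨟ mk (Z 1 1 1)) ⊠ mk (wires 1)) := by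
    have h0 : (mk (Z 1 2 0) ⨟ (mk (X 1 1 2) ⊠ mk hBox) ⨟ mk (Z 2 1 0) ⨟ mk (Z 1 1 1)) ⊠ mk (wires 1) =
        (mk (Z 1 2 0) ⊠ mk (wires 1)) ⨟ ((mk (X 1 1 2) ⨟ mk (Z 1 2 1)) ⊠ mk (wires 2)) ⨟ ((mk (wires 1) ⊠ ((mk hBox ⊠ mk (wires 1)) ⨟ mk cap)) ⊠ mk (wires 1)) := by
      rw [← hedge_inner_eq, seq_par_wires, seq_par_wires,
        show ((mk (X 1 1 2) ⨟ mk (Z 1 2 1)) ⊠ mk (wires 1)) ⊠ mk (wires 1) = (mk (X 1 1 2) ⨟ mk (Z 1 2 1)) ⊠ mk (wires 2) from by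
          rw [← wires_par_wires 1 1]; exact (par_assoc _ _ _).trans (cast_id _ _ _)]
    rw [seq_assoc (mk (Z 1 2 4)), interchange, id_seq, par_eq_seq_right (mk (X 1 1 2) ⨟ mk (Z 1 2 1)), ← seq_assoc (mk (Z 1 2 4)),
      Z_seq_par_Z 1 1 1 2 le_rfl, show (4 : ZMod 8) + -1 = 3 from by decide,
      show mk (Z 1 3 3) = mk (Z 1 2 3) ⨟ (mk (Z 1 2 0) ⊠ mk (wires 1)) from by rw [Z_seq_Z_par 1 1 1 2 le_rfl, zero_add], h0]
    simp only [seq_assoc]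
  rw [h1, ← one_two_seq_scalar_par_two, ← one_two_seq_scalar_par_two, ← scalar_par_one_par_one, ← scalar_par_one_par_one,
    ← scalar_par_seq_one (mk (dumbbell 0 0)) _ (mk (Z 1 1 1)), ← scalar_par_seq_one (mk (dumbbell 0 0)) _ (mk (Z 1 1 1)), split_Xhalfpi_hBox_merge,
    scalar_par_seq_one, scalar_par_seq_one, seq_assoc (mk (Z 1 0 (-2))), Z_seq_Z 0 1 1 le_rfl, show (-2 : ZMod 8) + 1 = -1 from by decide,
    scalar_par_one_par_one, scalar_par_one_par_one, one_two_seq_scalar_par_two, one_two_seq_scalar_par_two, seq_par_wires, ← seq_assoc,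
    Z_seq_Z_par 1 1 1 0 le_rfl, show (-2 : ZMod 8) + 3 = 1 from by decide]
  conv_rhs => rw [par_eq_seq_right (mk (Z 0 1 (-1))) (mk (Z 1 1 1)), empty_par, cast_id]

/-- Phases slide from the outer outputs of the hedge into the two splits — duplicate of
`hedgeSq_seq_phases` (`ZXCalculusC1Bis.lean`), kept as a deprecated alias (librarian dedup-01572).
[cite: JeandelPerdrixVilmart2018, Fig. 1 (S1)] -/
@[deprecated hedgeSq_seq_phases (since := "2026-08-16")]
alias splits_hedgecap_seq_phases := hedgeSq_seq_phases

/-- **Lemma 36, transposed core**: with `N' = X(π/2) ⨾ Z(π/4) ⨾ xLeafL 0 (π/4)` (the transposed triangle without its gadget),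
`db 4 (-1) ⊗ (Z^{(1,2)} ⨾ (N' ⊗ N') ⨾ Z^{(2,1)}) = (1/√2 ⊗ db 4 1) ⊗ (X(π/2) ⨾ (Z^{(0,1)}(-π/4) ⊗ Z(π/4)) ⨾ (xLeafL 0 (π/4) ⊗ xLeafR π (-π/4)) ⨾ Z^{(2,1)})`.
[cite: JeandelPerdrixVilmart2018, Appendix Lemma 36 (proof, first part)] -/
theorem first36_core :
    mk (dumbbell 4 (-1)) ⊠ (mk (Z 1 2 0) ⨟ ((mk (X 1 1 2) ⨟ mk (Z 1 1 1) ⨟ mk (xLeafL 0 1)) ⊠ (mk (X 1 1 2) ⨟ mk (Z 1 1 1) ⨟ mk (xLeafL 0 1))) ⨟ mk (Z 2 1 0)) =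
      mk invSqrtTwo ⊠ (mk (dumbbell 4 1) ⊠ (mk (X 1 1 2) ⨟ ((mk (Z 0 1 (-1)) ⊠ mk (Z 1 1 1)) ⨟ ((mk (xLeafL 0 1) ⊠ mk (xLeafR 4 (-1))) ⨟ mk (Z 2 1 0))))) := by
  have h10T : mk (Z 1 2 0) ⨟ (mk (X 1 1 2) ⊠ mk (X 1 1 2)) =
      mk (dumbbell 0 0) ⊠ (mk (X 1 1 2) ⨟ (mk (Z 1 2 4) ⨟ ((mk (wires 1) ⊠ mk hBox) ⨟ ((mk (wires 1) ⊠ mk (Z 1 2 0)) ⨟ (((mk hBox ⊠ mk hBox) ⨟ mk (Z 2 1 0)) ⊠ mk (wires 1)))))) := by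
    have h := congrArg transpose X_halfpis_seq_Z_merge
    simpa using h
  -- Steps A–C: `L10ᵀ`, and the hedge as `G₀(0,0)`
  have hC : (mk (wires 1) ⊠ mk (Z 1 2 0)) ⨟ (((mk hBox ⊠ mk hBox) ⨟ mk (Z 2 1 0)) ⊠ mk (wires 1)) =
      (mk hBox ⊠ mk (wires 1)) ⨟ (mk (Z 1 2 0) ⊠ mk (Z 1 2 0)) ⨟ ((mk (wires 1) ⊠ ((mk hBox ⊠ mk (wires 1)) ⨟ mk cap)) ⊠ mk (wires 1)) := by
    rw [← hBox_par_split_hBox_seq_merge, seq_par_wires, ← seq_assoc,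
      show (mk hBox ⊠ mk hBox) ⊠ mk (wires 1) = mk hBox ⊠ (mk hBox ⊠ mk (wires 1)) from (par_assoc _ _ _).trans (cast_id _ _ _), interchange, id_seq]
  have hK : mk (dumbbell 4 (-1)) ⊠ mk (xLeafL 0 1) = mk (dumbbell 0 0) ⊠ mk (xLeafL 4 (-1)) := by
    simpa using (dumbbell_four_par_xLeafL_neg 0 (-1))
  rw [seq_assoc (mk (X 1 1 2)) (mk (Z 1 1 1)) (mk (xLeafL 0 1)), ← interchange, ← seq_assoc (mk (Z 1 2 0)), h10T]
  simp only [seq_assoc]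
  rw [hC, scalar_par_one_two_seq_one]
  simp only [seq_assoc]
  -- Step D: phases into the splits, `Z^(1, 2)(π/4) = Z(π/2) ⨾ Z^(1, 2)(-π/4)` on the first wire, `H ⨾ Z(π/2) = X(π/2) ⨾ H`
  rw [← interchange, seq_assoc (mk (Z 1 1 1) ⊠ mk (Z 1 1 1)), ← seq_assoc ((mk (wires 1) ⊠ ((mk hBox ⊠ mk (wires 1)) ⨟ mk cap)) ⊠ mk (wires 1)) (mk (Z 1 1 1) ⊠ mk (Z 1 1 1)), ← seq_assoc (mk (Z 1 2 0) ⊠ mk (Z 1 2 0)) (((mk (wires 1) ⊠ ((mk hBox ⊠ mk (wires 1)) ⨟ mk cap)) ⊠ mk (wires 1)) ⨟ (mk (Z 1 1 1) ⊠ mk (Z 1 1 1))),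
    ← seq_assoc (mk (Z 1 2 0) ⊠ mk (Z 1 2 0)) ((mk (wires 1) ⊠ ((mk hBox ⊠ mk (wires 1)) ⨟ mk cap)) ⊠ mk (wires 1)) (mk (Z 1 1 1) ⊠ mk (Z 1 1 1)), hedgeSq_seq_phases,
    show mk (Z 1 2 1) ⊠ mk (Z 1 2 1) = (mk (Z 1 1 2) ⊠ mk (wires 1)) ⨟ (mk (Z 1 2 (-1)) ⊠ mk (Z 1 2 1)) from by
      rw [interchange, id_seq, Z_seq_Z 1 1 2 le_rfl, show (2 : ZMod 8) + -1 = 1 from by decide],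
    seq_assoc (mk (Z 1 1 2) ⊠ mk (wires 1)), seq_assoc (mk (Z 1 1 2) ⊠ mk (wires 1)), ← seq_assoc (mk hBox ⊠ mk (wires 1)) (mk (Z 1 1 2) ⊠ mk (wires 1)), ← seq_par_wires, hBox_seq_Z_phase,
    seq_par_wires, seq_assoc (mk (X 1 1 2) ⊠ mk (wires 1)), ← seq_assoc (mk (wires 1) ⊠ mk hBox) (mk (X 1 1 2) ⊠ mk (wires 1)), ← par_eq_seq_right,
    -- Step E: flip the left leaf with `db 4 (-1)`, the right leaf node is an `xLeafR`
    show mk (xLeafL 0 1) ⊠ mk (xLeafL 0 1) = mk (xLeafL 0 1) ⊠ mk (xLeafR 0 1) from by rw [← xLeafL_eq_xLeafR],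
    scalar_par_scalar_par (mk (dumbbell 4 (-1))) (mk (dumbbell 0 0)),
    ← seq_scalar_par_one (mk (dumbbell 4 (-1))) (mk (X 1 1 2)), ← one_two_seq_scalar_par_one, ← two_two_seq_scalar_par_one, ← two_two_seq_scalar_par_one,
    ← two_two_seq_scalar_par_one, ← scalar_par_two_two_seq_one (mk (dumbbell 4 (-1))) (mk (xLeafL 0 1) ⊠ mk (xLeafR 0 1)), ← scalar_par_one_par_one, hK,
    scalar_par_one_par_one, scalar_par_two_two_seq_one, two_two_seq_scalar_par_one, two_two_seq_scalar_par_one, two_two_seq_scalar_par_one,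
    one_two_seq_scalar_par_one, seq_scalar_par_one,
    -- Step F: (C1) on the gadget `G(-π/4, π/4)`, then `H ⨾ H = 𝕀`
    ← seq_assoc ((mk (Z 1 2 (-1)) ⊠ mk (Z 1 2 1)) ⨟ ((mk (wires 1) ⊠ ((mk hBox ⊠ mk (wires 1)) ⨟ mk cap)) ⊠ mk (wires 1))) (mk (xLeafL 4 (-1)) ⊠ mk (xLeafR 0 1)) (mk (Z 2 1 0)),
    ← seq_assoc (mk hBox ⊠ mk (wires 1)) _ (mk (Z 2 1 0)), ← seq_assoc (mk hBox ⊠ mk (wires 1)) _ (mk (xLeafL 4 (-1)) ⊠ mk (xLeafR 0 1)),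
    ← seq_assoc (mk hBox ⊠ mk (wires 1)) (mk (Z 1 2 (-1)) ⊠ mk (Z 1 2 1)) ((mk (wires 1) ⊠ ((mk hBox ⊠ mk (wires 1)) ⨟ mk cap)) ⊠ mk (wires 1)), c1Gadget_eq_mirror]
  simp only [seq_assoc]
  rw [← seq_assoc (mk (X 1 1 2) ⊠ mk hBox) (mk (wires 1) ⊠ mk hBox), interchange, seq_id, hBox_seq_hBox,
    -- Step G: the local disconnection
    ← seq_assoc (mk (Z 1 2 1) ⊠ mk (Z 1 2 (-1))) ((mk (wires 1) ⊠ ((mk hBox ⊠ mk (wires 1)) ⨟ mk cap)) ⊠ mk (wires 1)), ← seq_assoc (mk (X 1 1 2) ⊠ mk (wires 1)) ((mk (Z 1 2 1) ⊠ mk (Z 1 2 (-1))) ⨟ ((mk (wires 1) ⊠ ((mk hBox ⊠ mk (wires 1)) ⨟ mk cap)) ⊠ mk (wires 1))),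
    ← seq_assoc (mk (X 1 1 2) ⊠ mk (wires 1)) (mk (Z 1 2 1) ⊠ mk (Z 1 2 (-1))) ((mk (wires 1) ⊠ ((mk hBox ⊠ mk (wires 1)) ⨟ mk cap)) ⊠ mk (wires 1)), ← seq_assoc (mk (Z 1 2 4)) _ ((mk (xLeafL 0 1) ⊠ mk (xLeafR 4 (-1))) ⨟ mk (Z 2 1 0)),
    ← seq_assoc (mk (Z 1 2 4)) _ ((mk (wires 1) ⊠ ((mk hBox ⊠ mk (wires 1)) ⨟ mk cap)) ⊠ mk (wires 1)), ← seq_assoc (mk (Z 1 2 4)) (mk (X 1 1 2) ⊠ mk (wires 1)) (mk (Z 1 2 1) ⊠ mk (Z 1 2 (-1))),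
    ← seq_scalar_par_one (mk (dumbbell 0 0)) (mk (X 1 1 2)), ← seq_scalar_par_one (mk (dumbbell 0 0)) (mk (X 1 1 2)),
    ← scalar_par_one_two_seq_one, ← scalar_par_one_two_seq_one, pi_split_Xhalfpi_CZ, scalar_par_one_two_seq_one, scalar_par_one_two_seq_one,
    seq_scalar_par_one, seq_scalar_par_one]

/-- The leaf node is its own transpose (diagram-level transpose under `mk`). [cite: JeandelPerdrixVilmart2018, §2.2] -/
theorem mk_transpose_xLeafL (k c : ZMod 8) : mk (xLeafL k c).transpose = mk (xLeafL k c) := by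
  rw [← transpose_mk]; exact xLeafL_transpose k c

/-- `Gn ⨾ Gnπ = db 4 (-2) ⊗ 𝕀` (from `gadgetNode_pi_seq_gadgetNode` by conjugating with `X(π)`). [cite: JeandelPerdrixVilmart2018, Appendix Lemma 19] -/
theorem gadgetNode_seq_gadgetNode_pi : (mk (Z 1 2 0) ⨟ (mk (wires 1) ⊠ (mk (X 1 2 0) ⨟ (mk (Z 1 0 (-1)) ⊠ mk (Z 1 0 (-1)))))) ⨟ (mk (Z 1 2 0) ⨟ (mk (wires 1) ⊠ (mk (X 1 2 4) ⨟ (mk (Z 1 0 (-1)) ⊠ mk (Z 1 0 (-1)))))) = mk (dumbbell 4 (-2)) ⊠ mk (wires 1) := by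
  have hX : mk (X 1 1 4) ⨟ mk (X 1 1 4) = mk (wires 1) := by rw [xphase_seq_xphase, show (4 : ZMod 8) + 4 = 0 from by decide, X_one_one]
  rw [show (mk (Z 1 2 0) ⨟ (mk (wires 1) ⊠ (mk (X 1 2 4) ⨟ (mk (Z 1 0 (-1)) ⊠ mk (Z 1 0 (-1)))))) = mk (X 1 1 4) ⨟ ((mk (Z 1 2 0) ⨟ (mk (wires 1) ⊠ (mk (X 1 2 0) ⨟ (mk (Z 1 0 (-1)) ⊠ mk (Z 1 0 (-1)))))) ⨟ mk (X 1 1 4)) from by rw [gadgetNode_seq_X_pi, ← seq_assoc, hX, id_seq],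
    ← seq_assoc (mk (Z 1 2 0) ⨟ (mk (wires 1) ⊠ (mk (X 1 2 0) ⨟ (mk (Z 1 0 (-1)) ⊠ mk (Z 1 0 (-1)))))) (mk (X 1 1 4))]
  nth_rewrite 1 [gadgetNode_seq_X_pi]
  rw [seq_assoc (mk (X 1 1 4)), ← seq_assoc (mk (Z 1 2 0) ⨟ (mk (wires 1) ⊠ (mk (X 1 2 4) ⨟ (mk (Z 1 0 (-1)) ⊠ mk (Z 1 0 (-1)))))) (mk (Z 1 2 0) ⨟ (mk (wires 1) ⊠ (mk (X 1 2 0) ⨟ (mk (Z 1 0 (-1)) ⊠ mk (Z 1 0 (-1)))))) (mk (X 1 1 4)), gadgetNode_pi_seq_gadgetNode, scalar_par_seq_one, id_seq,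
    seq_scalar_par_one, hX]

/-- **Lemma 36, first part**: `db 4 (-1) ⊗ db 4 (-1) ⊗ (Z^{(1,2)} ⨾ (N ⊗ N) ⨾ Z^{(2,1)}) = √2 ⊗ (Gnπ ⨾ N)` with `N = xLeafL 0 (π/4) ⨾ Z(π/4) ⨾ X(π/2)`
the triangle without its gadget and `Gnπ` the green node carrying the `π`-gadget.
[cite: JeandelPerdrixVilmart2018, Appendix Lemma 36 (proof, first part)] -/
theorem first36 :
    mk (dumbbell 4 (-1)) ⊠ (mk (dumbbell 4 (-1)) ⊠ (mk (Z 1 2 0) ⨟ ((mk (xLeafL 0 1) ⨟ mk (Z 1 1 1) ⨟ mk (X 1 1 2)) ⊠ (mk (xLeafL 0 1) ⨟ mk (Z 1 1 1) ⨟ mk (X 1 1 2))) ⨟ mk (Z 2 1 0))) =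
      mk (dumbbell 0 0) ⊠ ((mk (Z 1 2 0) ⨟ (mk (wires 1) ⊠ (mk (X 1 2 4) ⨟ (mk (Z 1 0 (-1)) ⊠ mk (Z 1 0 (-1)))))) ⨟ (mk (xLeafL 0 1) ⨟ mk (Z 1 1 1) ⨟ mk (X 1 1 2))) := by
  have hK : mk (dumbbell 4 (-1)) ⊠ mk (xLeafL 0 1) = mk (dumbbell 0 0) ⊠ mk (xLeafL 4 (-1)) := by
    simpa using (dumbbell_four_par_xLeafL_neg 0 (-1))
  -- the transposed core, transposed back
  have h := first36_core
  rw [← xLeafL_eq_xLeafR 4 (-1)] at h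
  have h2 := congrArg (mk (dumbbell 0 0) ⊠ ·) h
  simp only [sqrt_two_par_invSqrtTwo_par_one] at h2
  have ht := congrArg transpose h2
  simp [mk_transpose_xLeafL] at ht
  -- `ht : √2 ⊗ (db ⊗ D0) = db 4 1 ⊗ (((Z12 ⨾ (xL ⊗ xL')) ⨾ (e₋ ⊗ Z1)) ⨾ X2)`
  have hD : mk (dumbbell 4 (-1)) ⊠ (mk (Z 1 2 0) ⨟ ((mk (xLeafL 0 1) ⨟ mk (Z 1 1 1) ⨟ mk (X 1 1 2)) ⊠ (mk (xLeafL 0 1) ⨟ mk (Z 1 1 1) ⨟ mk (X 1 1 2))) ⨟ mk (Z 2 1 0)) =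
      mk invSqrtTwo ⊠ (mk (dumbbell 4 1) ⊠ (((mk (Z 1 2 0) ⨟ (mk (xLeafL 0 1) ⊠ mk (xLeafL 4 (-1)))) ⨟ (mk (Z 1 0 (-1)) ⊠ mk (Z 1 1 1))) ⨟ mk (X 1 1 2))) := by
    have h3 := congrArg (mk invSqrtTwo ⊠ ·) ht
    simp only [invSqrtTwo_par_sqrt_two_par_one, seq_assoc] at h3
    simp only [seq_assoc]
    exact h3
  have hGL : mk (Z 1 2 0) ⨟ ((mk (xLeafL 0 1) ⨟ mk (Z 1 0 (-1))) ⊠ mk (wires 1)) = mk (Z 1 2 0) ⨟ (mk (wires 1) ⊠ (mk (xLeafL 0 1) ⨟ mk (Z 1 0 (-1)))) := by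
    conv_lhs => rw [← Z_seq_swap 1 0, seq_assoc, ← fswap1_one, fswap1_nat, fswap1_zero, seq_id]
  have hsc : ∀ (t : ZXClass 0 0) (F : ZXClass 1 0), t ⊠ (mk (wires 1) ⊠ F) = mk (wires 1) ⊠ (t ⊠ F) := fun t F => by
    rw [show mk (wires 1) ⊠ (t ⊠ F) = (mk (wires 1) ⊠ t) ⊠ F from (par_assoc' _ _ _).trans (cast_id _ _ _), ← scalar_par_one_comm]
    exact (par_assoc' _ _ _).trans (cast_id _ _ _)
  have hGp : mk (xLeafL 4 (-1)) ⨟ mk (Z 1 0 (-1)) = mk (X 1 2 4) ⨟ (mk (Z 1 0 (-1)) ⊠ mk (Z 1 0 (-1))) := by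
    simp only [xLeafL, mk_seq, mk_par]
    rw [par_eq_seq_left (mk (Z 1 0 (-1))) (mk (Z 1 0 (-1))), empty_par, cast_id, seq_assoc]
  rw [hD, seq_assoc (mk (Z 1 2 0)) (mk (xLeafL 0 1) ⊠ mk (xLeafL 4 (-1))), interchange, par_eq_seq_left (mk (xLeafL 0 1) ⨟ mk (Z 1 0 (-1))), empty_par, cast_id,
    ← seq_assoc (mk (Z 1 2 0)) ((mk (xLeafL 0 1) ⨟ mk (Z 1 0 (-1))) ⊠ mk (wires 1)), hGL,
    scalar_par_scalar_par (mk (dumbbell 4 (-1))) (mk invSqrtTwo), scalar_par_scalar_par (mk (dumbbell 4 (-1))) (mk (dumbbell 4 1)),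
    ← scalar_par_seq_one (mk (dumbbell 4 (-1))) _ (mk (X 1 1 2)), ← scalar_par_seq_one (mk (dumbbell 4 (-1))) _ (mk (xLeafL 4 (-1)) ⨟ mk (Z 1 1 1)),
    ← one_two_seq_scalar_par_one, hsc, ← scalar_par_one_seq_zero, hK, scalar_par_one_seq_zero, ← hsc, one_two_seq_scalar_par_one,
    scalar_par_seq_one (mk (dumbbell 0 0)) _ (mk (xLeafL 4 (-1)) ⨟ mk (Z 1 1 1)), ← seq_scalar_par_one (mk (dumbbell 0 0)) _ (mk (xLeafL 4 (-1)) ⨟ mk (Z 1 1 1)),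
    ← scalar_par_seq_one (mk (dumbbell 0 0)) (mk (xLeafL 4 (-1))) (mk (Z 1 1 1)), ← hK, scalar_par_seq_one, seq_scalar_par_one, scalar_par_seq_one, hGp,
    show ∀ Y : ZXClass 1 1, mk (dumbbell 4 1) ⊠ (mk (dumbbell 4 (-1)) ⊠ Y) = (mk (dumbbell 4 1) ⊠ mk (dumbbell 4 (-1))) ⊠ Y from fun Y => (par_assoc' _ _ _).trans (cast_id _ _ _),
    dumbbell_four_mul, show (1 : ZMod 8) + -1 = 0 from by decide, dumbbell_four_zero,
    show ∀ Y : ZXClass 1 1, (mk (dumbbell 0 0) ⊠ mk (dumbbell 0 0)) ⊠ Y = mk (dumbbell 0 0) ⊠ (mk (dumbbell 0 0) ⊠ Y) from fun Y => (par_assoc _ _ _).trans (cast_id _ _ _),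
    invSqrtTwo_par_sqrt_two_par_one]
  simp only [seq_assoc]


/-- The gadget on the second output of the copy also commutes to the input. [cite: JeandelPerdrixVilmart2018, Fig. 1 (S1)] -/
theorem split_seq_par_gadget : mk (Z 1 2 0) ⨟ (mk (wires 1) ⊠ (mk (Z 1 2 0) ⨟ (mk (wires 1) ⊠ (mk (X 1 2 0) ⨟ (mk (Z 1 0 (-1)) ⊠ mk (Z 1 0 (-1))))))) = (mk (Z 1 2 0) ⨟ (mk (wires 1) ⊠ (mk (X 1 2 0) ⨟ (mk (Z 1 0 (-1)) ⊠ mk (Z 1 0 (-1)))))) ⨟ mk (Z 1 2 0) := by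
  rw [← Z_seq_swap 1 0, seq_assoc (mk (Z 1 2 0)) (mk swap), swap_seq_par_phase, ← seq_assoc (mk (Z 1 2 0)), Z_seq_swap, split_seq_gadget_par,
    seq_assoc, Z_seq_swap]

/-- **Appendix Lemma 36** (`parallel-triangles`): `Z^{(1,2)} ⨾ (T ⊗ T) ⨾ Z^{(2,1)} = T`.
[cite: JeandelPerdrixVilmart2018, Appendix Lemma 36] -/
theorem parallel_triangles : mk (Z 1 2 0) ⨟ (mk triangle ⊠ mk triangle) ⨟ mk (Z 2 1 0) = mk triangle := by
  have hT : mk triangle = (mk (Z 1 2 0) ⨟ (mk (wires 1) ⊠ (mk (X 1 2 0) ⨟ (mk (Z 1 0 (-1)) ⊠ mk (Z 1 0 (-1)))))) ⨟ (mk (xLeafL 0 1) ⨟ mk (Z 1 1 1) ⨟ mk (X 1 1 2)) := by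
    rw [mk_triangle, seq_assoc, seq_assoc, ← seq_assoc (mk (xLeafL 0 1))]
  refine cancel_dumbbell_four_one_one (-1) (cancel_dumbbell_four_one_one (-1) ?_)
  rw [hT, ← interchange, ← seq_assoc (mk (Z 1 2 0)), par_eq_seq_left (mk (Z 1 2 0) ⨟ (mk (wires 1) ⊠ (mk (X 1 2 0) ⨟ (mk (Z 1 0 (-1)) ⊠ mk (Z 1 0 (-1)))))) (mk (Z 1 2 0) ⨟ (mk (wires 1) ⊠ (mk (X 1 2 0) ⨟ (mk (Z 1 0 (-1)) ⊠ mk (Z 1 0 (-1)))))), ← seq_assoc (mk (Z 1 2 0)), split_seq_gadget_par,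
    seq_assoc (mk (Z 1 2 0) ⨟ (mk (wires 1) ⊠ (mk (X 1 2 0) ⨟ (mk (Z 1 0 (-1)) ⊠ mk (Z 1 0 (-1)))))) (mk (Z 1 2 0)), split_seq_par_gadget, seq_assoc (mk (Z 1 2 0) ⨟ (mk (wires 1) ⊠ (mk (X 1 2 0) ⨟ (mk (Z 1 0 (-1)) ⊠ mk (Z 1 0 (-1)))))), seq_assoc (mk (Z 1 2 0) ⨟ (mk (wires 1) ⊠ (mk (X 1 2 0) ⨟ (mk (Z 1 0 (-1)) ⊠ mk (Z 1 0 (-1)))))), seq_assoc (mk (Z 1 2 0) ⨟ (mk (wires 1) ⊠ (mk (X 1 2 0) ⨟ (mk (Z 1 0 (-1)) ⊠ mk (Z 1 0 (-1)))))), seq_assoc (mk (Z 1 2 0) ⨟ (mk (wires 1) ⊠ (mk (X 1 2 0) ⨟ (mk (Z 1 0 (-1)) ⊠ mk (Z 1 0 (-1)))))),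
    ← seq_scalar_par_one (mk (dumbbell 4 (-1))) (mk (Z 1 2 0) ⨟ (mk (wires 1) ⊠ (mk (X 1 2 0) ⨟ (mk (Z 1 0 (-1)) ⊠ mk (Z 1 0 (-1)))))), ← seq_scalar_par_one (mk (dumbbell 4 (-1))) (mk (Z 1 2 0) ⨟ (mk (wires 1) ⊠ (mk (X 1 2 0) ⨟ (mk (Z 1 0 (-1)) ⊠ mk (Z 1 0 (-1)))))),
    ← seq_scalar_par_one (mk (dumbbell 4 (-1))) (mk (Z 1 2 0) ⨟ (mk (wires 1) ⊠ (mk (X 1 2 0) ⨟ (mk (Z 1 0 (-1)) ⊠ mk (Z 1 0 (-1)))))), ← seq_scalar_par_one (mk (dumbbell 4 (-1))) (mk (Z 1 2 0) ⨟ (mk (wires 1) ⊠ (mk (X 1 2 0) ⨟ (mk (Z 1 0 (-1)) ⊠ mk (Z 1 0 (-1)))))),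
    first36, seq_scalar_par_one, seq_scalar_par_one,
    ← seq_assoc (mk (Z 1 2 0) ⨟ (mk (wires 1) ⊠ (mk (X 1 2 0) ⨟ (mk (Z 1 0 (-1)) ⊠ mk (Z 1 0 (-1)))))) (mk (Z 1 2 0) ⨟ (mk (wires 1) ⊠ (mk (X 1 2 4) ⨟ (mk (Z 1 0 (-1)) ⊠ mk (Z 1 0 (-1)))))), ← seq_assoc (mk (Z 1 2 0) ⨟ (mk (wires 1) ⊠ (mk (X 1 2 0) ⨟ (mk (Z 1 0 (-1)) ⊠ mk (Z 1 0 (-1)))))) ((mk (Z 1 2 0) ⨟ (mk (wires 1) ⊠ (mk (X 1 2 0) ⨟ (mk (Z 1 0 (-1)) ⊠ mk (Z 1 0 (-1)))))) ⨟ (mk (Z 1 2 0) ⨟ (mk (wires 1) ⊠ (mk (X 1 2 4) ⨟ (mk (Z 1 0 (-1)) ⊠ mk (Z 1 0 (-1))))))), gadgetNode_seq_gadgetNode_pi, seq_scalar_par_one, seq_id,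
    scalar_par_seq_one, scalar_par_scalar_par (mk (dumbbell 0 0)) (mk (dumbbell 4 (-2))),
    show ∀ Y : ZXClass 1 1, mk (dumbbell 4 (-1)) ⊠ (mk (dumbbell 4 (-1)) ⊠ Y) = (mk (dumbbell 4 (-1)) ⊠ mk (dumbbell 4 (-1))) ⊠ Y from
      fun Y => (par_assoc' _ _ _).trans (cast_id _ _ _),
    dumbbell_four_mul, show (-1 : ZMod 8) + -1 = -2 from by decide,
    show ∀ Y : ZXClass 1 1, (mk (dumbbell 4 (-2)) ⊠ mk (dumbbell 0 0)) ⊠ Y = mk (dumbbell 4 (-2)) ⊠ (mk (dumbbell 0 0) ⊠ Y) from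
      fun Y => (par_assoc _ _ _).trans (cast_id _ _ _)]

end ZXClass

end Literature.Computability.QuantumComplexity
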